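import Mathlib
import Summits.Ventures.PercRepro2.Defs
import Summits.Ventures.PercRepro2.CoinTraceBlock
import Summits.Ventures.PercRepro2.CoinTraceShift
import Summits.Ventures.PercRepro2.CoinTraceBlocks
import Summits.Ventures.PercRepro2.CoinTraceBlocks2
import Summits.Ventures.PercRepro2.CoinPathStarHard

/-!
# The abstract pendant lemma for the PATHSTAR trace family on ALL regimes (blind cell PercRepro2,
night-2 g4; proofs/NIGHT2-DARC.md §23.2)

With the hard family `H = 𝒩_w ∪ {Z : v₂ ∈ Z ∧ v₃ ∈ Z}` (`pathStar_hard_block_nonneg`) as a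
SEVENTH good family, the pivotal weight `ρ` of the pathstar has a pointwise NONNEGATIVE
decomposition `ρ = Σ_j c_j 1_{F_j}` for every monotone `ρ` (`pathStar_rho_decomp₇` with the
coefficients of `pathStar_functional_nonneg'`: `c₅ = max(0, ρ_A + ρ_B − ρ_P)`,
`c₄ = ρ_B − c₅`, `c₃ = min(ρ_A − c₅, ρ_C − ρ_B)`, `c₆ = ρ_C − ρ_B − c₃`, `c₂ = ρ_A − c₃ − c₅`,
`c₁ = ρ_P − ρ_C − c₂`, `c₀ = 1 − ρ_P`, written out as a three-way case split), hence
`S′ = Σ_j c_j G(F_j) ≥ 0` — the subadditivity hypothesis `ρ_C ≤ ρ_A + ρ_B` of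
`pathStar_functional_nonneg` (§19) is gone.
-/

namespace Summit.Ventures.PercRepro2.Coin

section PathStarAll

open Classical

variable {V : Type*} [DecidableEq V] {R : Type*} [Field R] [LinearOrder R] [IsStrictOrderedRing R]

omit [LinearOrder R] [IsStrictOrderedRing R] in
/-- The pointwise decomposition of the pivotal weight on the pathstar family into the SEVEN good
families, for coefficients satisfying the four identities at the pivotal traces and `Σ c = 1`. -/
lemma pathStar_rho_decomp₇ {w v₁ v₂ v₃ : V} (hwv₁ : w ≠ v₁) (hwv₂ : w ≠ v₂) (hwv₃ : w ≠ v₃)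
    (hv₁₂ : v₁ ≠ v₂) (hv₁₃ : v₁ ≠ v₃) (hv₂₃ : v₂ ≠ v₃) (μ ρ : Finset V → R)
    (c₀ c₁ c₂ c₃ c₄ c₅ c₆ : R)
    (hμ0a : ∀ Z ∈ ({w, v₁, v₂, v₃} : Finset V).powerset, v₁ ∈ Z → v₂ ∉ Z → μ Z = 0)
    (hμ0b : ∀ Z ∈ ({w, v₁, v₂, v₃} : Finset V).powerset, w ∈ Z → ¬ (v₁ ∈ Z ∧ v₂ ∈ Z) → v₃ ∉ Z → μ Z = 0)
    (hρ1 : ∀ Z ∈ ({w, v₁, v₂, v₃} : Finset V).powerset, w ∉ Z → ρ Z = 1)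
    (hA : ρ {w, v₁, v₂} = c₂ + c₃ + c₅) (hB : ρ {w, v₃} = c₄ + c₅)
    (hC : ρ {w, v₂, v₃} = c₃ + c₄ + c₅ + c₆)
    (hP : ρ ({w, v₁, v₂, v₃} : Finset V) = c₁ + c₂ + c₃ + c₄ + c₅ + c₆)
    (hsum : c₀ + c₁ + c₂ + c₃ + c₄ + c₅ + c₆ = 1)
    {Z : Finset V} (hZ : Z ∈ ({w, v₁, v₂, v₃} : Finset V).powerset) :
    μ Z * ρ Z = μ Z * (c₀ * (if Disjoint Z {w} then (1 : R) else 0)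
      + c₁ * (if Disjoint Z {w} ∨ Z = ({w, v₁, v₂, v₃} : Finset V) then (1 : R) else 0)
      + c₂ * (if Disjoint Z {w} ∨ v₁ ∈ Z then (1 : R) else 0)
      + c₃ * (if Disjoint Z {w} ∨ v₂ ∈ Z then (1 : R) else 0)
      + c₄ * (if Disjoint Z {w} ∨ v₃ ∈ Z then (1 : R) else 0)
      + c₅
      + c₆ * (if Disjoint Z {w} ∨ (v₂ ∈ Z ∧ v₃ ∈ Z) then (1 : R) else 0)) := by
  have hZP : Z ⊆ ({w, v₁, v₂, v₃} : Finset V) := Finset.mem_powerset.mp hZ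
  by_cases hw : w ∈ Z
  · have hd : ¬ Disjoint Z {w} := fun h => Finset.disjoint_singleton_right.mp h hw
    by_cases hv₁ : v₁ ∈ Z <;> by_cases hv₂ : v₂ ∈ Z <;> by_cases hv₃ : v₃ ∈ Z
    · -- `Z = P`
      have hZe : Z = ({w, v₁, v₂, v₃} : Finset V) := by
        ext z
        constructor
        · exact fun h => hZP h
        · intro h
          simp only [Finset.mem_insert, Finset.mem_singleton] at h
          rcases h with rfl | rfl | rfl | rfl <;> assumption
      rw [if_neg hd, if_pos (Or.inr hZe), if_pos (Or.inr hv₁), if_pos (Or.inr hv₂),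
        if_pos (Or.inr hv₃), if_pos (Or.inr ⟨hv₂, hv₃⟩), hZe, hP]
      ring
    · -- `Z = {w, v₁, v₂}`
      have hZe : Z = {w, v₁, v₂} := by
        ext z
        constructor
        · intro h
          have := hZP h
          simp only [Finset.mem_insert, Finset.mem_singleton] at this ⊢
          rcases this with rfl | rfl | rfl | rfl
          · exact Or.inl rfl
          · exact Or.inr (Or.inl rfl)
          · exact Or.inr (Or.inr rfl)
          · exact absurd h hv₃
        · intro h
          simp only [Finset.mem_insert, Finset.mem_singleton] at h
          rcases h with rfl | rfl | rfl <;> assumption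
      have hZP' : Z ≠ ({w, v₁, v₂, v₃} : Finset V) := by
        intro h; exact hv₃ (h ▸ (by simp))
      simp only [hd, hv₁, hv₂, hv₃, hZP', or_true, if_true, or_false, if_false, and_false]
      rw [hZe, hA]
      ring
    · -- `v₁ ∈ Z`, `v₂ ∉ Z`: zero mass
      rw [hμ0a Z hZ hv₁ hv₂]
      ring
    · rw [hμ0a Z hZ hv₁ hv₂]
      ring
    · -- `Z = {w, v₂, v₃}`
      have hZe : Z = {w, v₂, v₃} := by
        ext z
        constructor
        · intro h
          have := hZP h
          simp only [Finset.mem_insert, Finset.mem_singleton] at this ⊢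
          rcases this with rfl | rfl | rfl | rfl
          · exact Or.inl rfl
          · exact absurd h hv₁
          · exact Or.inr (Or.inl rfl)
          · exact Or.inr (Or.inr rfl)
        · intro h
          simp only [Finset.mem_insert, Finset.mem_singleton] at h
          rcases h with rfl | rfl | rfl <;> assumption
      have hZP' : Z ≠ ({w, v₁, v₂, v₃} : Finset V) := by
        intro h; exact hv₁ (h ▸ (by simp))
      simp only [hd, hv₁, hv₂, hv₃, hZP', or_true, if_true, or_false, if_false, and_true]
      rw [hZe, hC]
      ring
    · -- `v₂ ∈ Z`, `v₁, v₃ ∉ Z`: zero mass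
      rw [hμ0b Z hZ hw (fun h => hv₁ h.1) hv₃]
      ring
    · -- `Z = {w, v₃}`
      have hZe : Z = {w, v₃} := by
        ext z
        constructor
        · intro h
          have := hZP h
          simp only [Finset.mem_insert, Finset.mem_singleton] at this ⊢
          rcases this with rfl | rfl | rfl | rfl
          · exact Or.inl rfl
          · exact absurd h hv₁
          · exact absurd h hv₂
          · exact Or.inr rfl
        · intro h
          simp only [Finset.mem_insert, Finset.mem_singleton] at h
          rcases h with rfl | rfl <;> assumption
      have hZP' : Z ≠ ({w, v₁, v₂, v₃} : Finset V) := by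
        intro h; exact hv₁ (h ▸ (by simp))
      simp only [hd, hv₁, hv₂, hv₃, hZP', or_true, if_true, or_false, if_false, false_and]
      rw [hZe, hB]
      ring
    · -- `Z = {w}`: zero mass
      rw [hμ0b Z hZ hw (fun h => hv₁ h.1) hv₃]
      ring
  · have hd : Disjoint Z {w} := Finset.disjoint_singleton_right.mpr hw
    rw [hρ1 Z hZ hw]
    simp only [hd, true_or, if_true]
    linear_combination (-(μ Z)) * hsum

/-- **The abstract pathstar lemma from a nonnegative seven-family decomposition of `ρ`.** -/
theorem pathStar_functional_nonneg_of_coeffs {w v₁ v₂ v₃ : V} (hwv₁ : w ≠ v₁) (hwv₂ : w ≠ v₂)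
    (hwv₃ : w ≠ v₃) (hv₁₂ : v₁ ≠ v₂) (hv₁₃ : v₁ ≠ v₃) (hv₂₃ : v₂ ≠ v₃)
    (μ x y xh yh ρ : Finset V → R) (c₀ c₁ c₂ c₃ c₄ c₅ c₆ : R)
    (hμ : ∀ Z ∈ ({w, v₁, v₂, v₃} : Finset V).powerset, 0 ≤ μ Z)
    (hμ0a : ∀ Z ∈ ({w, v₁, v₂, v₃} : Finset V).powerset, v₁ ∈ Z → v₂ ∉ Z → μ Z = 0)
    (hμ0b : ∀ Z ∈ ({w, v₁, v₂, v₃} : Finset V).powerset, w ∈ Z → ¬ (v₁ ∈ Z ∧ v₂ ∈ Z) → v₃ ∉ Z → μ Z = 0)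
    (hx1 : ∀ Z : Finset V, Z ⊆ ({w, v₁, v₂, v₃} : Finset V) → x Z ≤ 1)
    (hy1 : ∀ Z : Finset V, Z ⊆ ({w, v₁, v₂, v₃} : Finset V) → y Z ≤ 1)
    (hxh1 : ∀ Z : Finset V, Z ⊆ ({w, v₁, v₂, v₃} : Finset V) → xh Z ≤ 1)
    (hyh1 : ∀ Z : Finset V, Z ⊆ ({w, v₁, v₂, v₃} : Finset V) → yh Z ≤ 1)
    (hxanti : ∀ Z Z' : Finset V, Z ⊆ Z' → Z' ⊆ ({w, v₁, v₂, v₃} : Finset V) → x Z' ≤ x Z)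
    (hyanti : ∀ Z Z' : Finset V, Z ⊆ Z' → Z' ⊆ ({w, v₁, v₂, v₃} : Finset V) → y Z' ≤ y Z)
    (hxhanti : ∀ Z Z' : Finset V, Z ⊆ Z' → Z' ⊆ ({w, v₁, v₂, v₃} : Finset V) → xh Z' ≤ xh Z)
    (hyhanti : ∀ Z Z' : Finset V, Z ⊆ Z' → Z' ⊆ ({w, v₁, v₂, v₃} : Finset V) → yh Z' ≤ yh Z)
    (hxh_le : ∀ Z : Finset V, Z ⊆ ({w, v₁, v₂, v₃} : Finset V) → xh Z ≤ x Z)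
    (hyh_le : ∀ Z : Finset V, Z ⊆ ({w, v₁, v₂, v₃} : Finset V) → yh Z ≤ y Z)
    (hxh_eq : ∀ Z : Finset V, Z ⊆ ({w, v₁, v₂, v₃} : Finset V) → w ∉ Z → xh Z = x Z)
    (hyh_eq : ∀ Z : Finset V, Z ⊆ ({w, v₁, v₂, v₃} : Finset V) → w ∉ Z → yh Z = y Z)
    (hρ1 : ∀ Z ∈ ({w, v₁, v₂, v₃} : Finset V).powerset, w ∉ Z → ρ Z = 1)
    (hc₀ : 0 ≤ c₀) (hc₁ : 0 ≤ c₁) (hc₂ : 0 ≤ c₂) (hc₃ : 0 ≤ c₃) (hc₄ : 0 ≤ c₄) (hc₅ : 0 ≤ c₅)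
    (hc₆ : 0 ≤ c₆)
    (hA : ρ {w, v₁, v₂} = c₂ + c₃ + c₅) (hB : ρ {w, v₃} = c₄ + c₅)
    (hC : ρ {w, v₂, v₃} = c₃ + c₄ + c₅ + c₆)
    (hP : ρ ({w, v₁, v₂, v₃} : Finset V) = c₁ + c₂ + c₃ + c₄ + c₅ + c₆)
    (hsum : c₀ + c₁ + c₂ + c₃ + c₄ + c₅ + c₆ = 1)
    (hPA : TracePA ({w, v₁, v₂, v₃} : Finset V) μ)
    (hCU₁ : TraceCUPA ({w, v₁, v₂, v₃} : Finset V) μ v₁)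
    (hCU₂ : TraceCUPA ({w, v₁, v₂, v₃} : Finset V) μ v₂)
    (hCU₃ : TraceCUPA ({w, v₁, v₂, v₃} : Finset V) μ v₃)
    (hCU₂₃ : ∀ f₁ f₂ : Finset V → R,
      (∀ Z Z' : Finset V, Z ⊆ Z' → Z' ⊆ ({w, v₁, v₂, v₃} : Finset V) → f₁ Z ≤ f₁ Z') →
      (∀ Z Z' : Finset V, Z ⊆ Z' → Z' ⊆ ({w, v₁, v₂, v₃} : Finset V) → f₂ Z ≤ f₂ Z') →
      (∀ Z : Finset V, Z ⊆ ({w, v₁, v₂, v₃} : Finset V) → 0 ≤ f₁ Z) →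
      (∀ Z : Finset V, Z ⊆ ({w, v₁, v₂, v₃} : Finset V) → 0 ≤ f₂ Z) →
      (∑ Z ∈ ({w, v₁, v₂, v₃} : Finset V).powerset.filter (fun Z => v₂ ∈ Z ∧ v₃ ∈ Z), f₁ Z * μ Z) *
          (∑ Z ∈ ({w, v₁, v₂, v₃} : Finset V).powerset.filter (fun Z => v₂ ∈ Z ∧ v₃ ∈ Z), f₂ Z * μ Z) ≤
        (∑ Z ∈ ({w, v₁, v₂, v₃} : Finset V).powerset.filter (fun Z => v₂ ∈ Z ∧ v₃ ∈ Z), f₁ Z * f₂ Z * μ Z) *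
          ∑ Z ∈ ({w, v₁, v₂, v₃} : Finset V).powerset.filter (fun Z => v₂ ∈ Z ∧ v₃ ∈ Z), μ Z) :
    0 ≤ ∑ Z ∈ ({w, v₁, v₂, v₃} : Finset V).powerset, μ Z * ρ Z *
      (xh Z * (∑ Z' ∈ ({w, v₁, v₂, v₃} : Finset V).powerset, μ Z') - ∑ Z' ∈ ({w, v₁, v₂, v₃} : Finset V).powerset, x Z' * μ Z') *
      (yh Z * (∑ Z' ∈ ({w, v₁, v₂, v₃} : Finset V).powerset, μ Z') - ∑ Z' ∈ ({w, v₁, v₂, v₃} : Finset V).powerset, y Z' * μ Z') := by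
  have hwP : w ∈ ({w, v₁, v₂, v₃} : Finset V) := by simp
  have hv₁P : v₁ ∈ ({w, v₁, v₂, v₃} : Finset V) := by simp
  have hv₂P : v₂ ∈ ({w, v₁, v₂, v₃} : Finset V) := by simp
  have hv₃P : v₃ ∈ ({w, v₁, v₂, v₃} : Finset V) := by simp
  obtain ⟨Λ, hΛ⟩ : ∃ L : R, L = ∑ Z ∈ ({w, v₁, v₂, v₃} : Finset V).powerset, μ Z := ⟨_, rfl⟩
  obtain ⟨MX, hMX⟩ : ∃ M : R, M = ∑ Z ∈ ({w, v₁, v₂, v₃} : Finset V).powerset, x Z * μ Z := ⟨_, rfl⟩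
  obtain ⟨MY, hMY⟩ : ∃ M : R, M = ∑ Z ∈ ({w, v₁, v₂, v₃} : Finset V).powerset, y Z * μ Z := ⟨_, rfl⟩
  have hA' := avoid_block_nonneg ({w, v₁, v₂, v₃} : Finset V) hwP μ x y xh yh hμ hx1 hy1 hxh1 hyh1 hxanti hyanti hxhanti
    hyhanti hxh_eq hyh_eq hPA
  have hT := top_block_nonneg ({w, v₁, v₂, v₃} : Finset V) hwP μ x y xh yh hμ hx1 hy1 hxh1 hyh1 hxanti hyanti hxhanti
    hyhanti hxh_le hyh_le hxh_eq hyh_eq hPA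
  have hC₁ := cylinder_block_nonneg ({w, v₁, v₂, v₃} : Finset V) hwP hv₁P μ x y xh yh hμ hx1 hy1 hxh1 hyh1 hxanti hyanti
    hxhanti hyhanti hxh_le hyh_le hxh_eq hyh_eq hPA hCU₁
  have hC₂ := cylinder_block_nonneg ({w, v₁, v₂, v₃} : Finset V) hwP hv₂P μ x y xh yh hμ hx1 hy1 hxh1 hyh1 hxanti hyanti
    hxhanti hyhanti hxh_le hyh_le hxh_eq hyh_eq hPA hCU₂
  have hC₃ := cylinder_block_nonneg ({w, v₁, v₂, v₃} : Finset V) hwP hv₃P μ x y xh yh hμ hx1 hy1 hxh1 hyh1 hxanti hyanti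
    hxhanti hyhanti hxh_le hyh_le hxh_eq hyh_eq hPA hCU₃
  have hD := all_block_nonneg ({w, v₁, v₂, v₃} : Finset V) μ x y xh yh hμ hxh1 hyh1 hxhanti hyhanti hxh_le hyh_le hPA
  have hH := pathStar_hard_block_nonneg hwv₁ hwv₂ hwv₃ hv₁₂ hv₁₃ hv₂₃ μ x y xh yh hμ hμ0a hx1 hy1
    hxh1 hyh1 hxanti hyanti hxhanti hyhanti hxh_le hyh_le hxh_eq hyh_eq hPA hCU₃ hCU₂₃
  rw [← hΛ, ← hMX, ← hMY] at hA' hT hC₁ hC₂ hC₃ hD hH ⊢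
  -- ABEL over the seven families
  have hdec : ∑ Z ∈ ({w, v₁, v₂, v₃} : Finset V).powerset, μ Z * ρ Z * (xh Z * Λ - MX) * (yh Z * Λ - MY) =
      c₀ * ∑ Z ∈ ({w, v₁, v₂, v₃} : Finset V).powerset.filter (fun Z => Disjoint Z {w}),
          μ Z * (xh Z * Λ - MX) * (yh Z * Λ - MY)
      + c₁ * ∑ Z ∈ ({w, v₁, v₂, v₃} : Finset V).powerset.filter (fun Z => Disjoint Z {w} ∨ Z = ({w, v₁, v₂, v₃} : Finset V)),
            μ Z * (xh Z * Λ - MX) * (yh Z * Λ - MY)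
      + c₂ * ∑ Z ∈ ({w, v₁, v₂, v₃} : Finset V).powerset.filter (fun Z => Disjoint Z {w} ∨ v₁ ∈ Z),
            μ Z * (xh Z * Λ - MX) * (yh Z * Λ - MY)
      + c₃ * ∑ Z ∈ ({w, v₁, v₂, v₃} : Finset V).powerset.filter (fun Z => Disjoint Z {w} ∨ v₂ ∈ Z),
            μ Z * (xh Z * Λ - MX) * (yh Z * Λ - MY)
      + c₄ * ∑ Z ∈ ({w, v₁, v₂, v₃} : Finset V).powerset.filter (fun Z => Disjoint Z {w} ∨ v₃ ∈ Z),
            μ Z * (xh Z * Λ - MX) * (yh Z * Λ - MY)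
      + c₅ * ∑ Z ∈ ({w, v₁, v₂, v₃} : Finset V).powerset, μ Z * (xh Z * Λ - MX) * (yh Z * Λ - MY)
      + c₆ * ∑ Z ∈ ({w, v₁, v₂, v₃} : Finset V).powerset.filter (fun Z => Disjoint Z {w} ∨ (v₂ ∈ Z ∧ v₃ ∈ Z)),
            μ Z * (xh Z * Λ - MX) * (yh Z * Λ - MY) := by
    have e : ∀ Z ∈ ({w, v₁, v₂, v₃} : Finset V).powerset, μ Z * ρ Z * (xh Z * Λ - MX) * (yh Z * Λ - MY) =
        c₀ * ((if Disjoint Z {w} then (1 : R) else 0) * (μ Z * (xh Z * Λ - MX) * (yh Z * Λ - MY)))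
        + c₁ * ((if Disjoint Z {w} ∨ Z = ({w, v₁, v₂, v₃} : Finset V) then (1 : R) else 0) *
            (μ Z * (xh Z * Λ - MX) * (yh Z * Λ - MY)))
        + c₂ * ((if Disjoint Z {w} ∨ v₁ ∈ Z then (1 : R) else 0) *
            (μ Z * (xh Z * Λ - MX) * (yh Z * Λ - MY)))
        + c₃ * ((if Disjoint Z {w} ∨ v₂ ∈ Z then (1 : R) else 0) *
            (μ Z * (xh Z * Λ - MX) * (yh Z * Λ - MY)))
        + c₄ * ((if Disjoint Z {w} ∨ v₃ ∈ Z then (1 : R) else 0) *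
            (μ Z * (xh Z * Λ - MX) * (yh Z * Λ - MY)))
        + c₅ * (μ Z * (xh Z * Λ - MX) * (yh Z * Λ - MY))
        + c₆ * ((if Disjoint Z {w} ∨ (v₂ ∈ Z ∧ v₃ ∈ Z) then (1 : R) else 0) *
            (μ Z * (xh Z * Λ - MX) * (yh Z * Λ - MY))) := by
      intro Z hZ
      have hd := pathStar_rho_decomp₇ hwv₁ hwv₂ hwv₃ hv₁₂ hv₁₃ hv₂₃ μ ρ c₀ c₁ c₂ c₃ c₄ c₅ c₆ hμ0a
        hμ0b hρ1 hA hB hC hP hsum hZ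
      rw [show μ Z * ρ Z * (xh Z * Λ - MX) * (yh Z * Λ - MY) =
        (μ Z * ρ Z) * ((xh Z * Λ - MX) * (yh Z * Λ - MY)) by ring, hd]
      ring
    rw [Finset.sum_congr rfl e, Finset.sum_add_distrib, Finset.sum_add_distrib,
      Finset.sum_add_distrib, Finset.sum_add_distrib, Finset.sum_add_distrib,
      Finset.sum_add_distrib,
      ← Finset.mul_sum, ← Finset.mul_sum, ← Finset.mul_sum, ← Finset.mul_sum, ← Finset.mul_sum,
      ← Finset.mul_sum, ← Finset.mul_sum, sum_ite_mul_eq_sum_filter, sum_ite_mul_eq_sum_filter,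
      sum_ite_mul_eq_sum_filter, sum_ite_mul_eq_sum_filter, sum_ite_mul_eq_sum_filter,
      sum_ite_mul_eq_sum_filter]
  rw [hdec]
  exact add_nonneg (add_nonneg (add_nonneg (add_nonneg (add_nonneg (add_nonneg
    (mul_nonneg hc₀ hA') (mul_nonneg hc₁ hT)) (mul_nonneg hc₂ hC₁)) (mul_nonneg hc₃ hC₂))
    (mul_nonneg hc₄ hC₃)) (mul_nonneg hc₅ hD)) (mul_nonneg hc₆ hH)

/-- **The abstract pendant lemma for the pathstar family on ALL regimes** (NIGHT2-DARC.md §23.2):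
only the monotonicity of the pivotal weight is needed. -/
theorem pathStar_functional_nonneg' {w v₁ v₂ v₃ : V} (hwv₁ : w ≠ v₁) (hwv₂ : w ≠ v₂)
    (hwv₃ : w ≠ v₃) (hv₁₂ : v₁ ≠ v₂) (hv₁₃ : v₁ ≠ v₃) (hv₂₃ : v₂ ≠ v₃)
    (μ x y xh yh ρ : Finset V → R)
    (hμ : ∀ Z ∈ ({w, v₁, v₂, v₃} : Finset V).powerset, 0 ≤ μ Z)
    (hμ0a : ∀ Z ∈ ({w, v₁, v₂, v₃} : Finset V).powerset, v₁ ∈ Z → v₂ ∉ Z → μ Z = 0)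
    (hμ0b : ∀ Z ∈ ({w, v₁, v₂, v₃} : Finset V).powerset, w ∈ Z → ¬ (v₁ ∈ Z ∧ v₂ ∈ Z) → v₃ ∉ Z → μ Z = 0)
    (hx1 : ∀ Z : Finset V, Z ⊆ ({w, v₁, v₂, v₃} : Finset V) → x Z ≤ 1)
    (hy1 : ∀ Z : Finset V, Z ⊆ ({w, v₁, v₂, v₃} : Finset V) → y Z ≤ 1)
    (hxh1 : ∀ Z : Finset V, Z ⊆ ({w, v₁, v₂, v₃} : Finset V) → xh Z ≤ 1)
    (hyh1 : ∀ Z : Finset V, Z ⊆ ({w, v₁, v₂, v₃} : Finset V) → yh Z ≤ 1)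
    (hxanti : ∀ Z Z' : Finset V, Z ⊆ Z' → Z' ⊆ ({w, v₁, v₂, v₃} : Finset V) → x Z' ≤ x Z)
    (hyanti : ∀ Z Z' : Finset V, Z ⊆ Z' → Z' ⊆ ({w, v₁, v₂, v₃} : Finset V) → y Z' ≤ y Z)
    (hxhanti : ∀ Z Z' : Finset V, Z ⊆ Z' → Z' ⊆ ({w, v₁, v₂, v₃} : Finset V) → xh Z' ≤ xh Z)
    (hyhanti : ∀ Z Z' : Finset V, Z ⊆ Z' → Z' ⊆ ({w, v₁, v₂, v₃} : Finset V) → yh Z' ≤ yh Z)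
    (hxh_le : ∀ Z : Finset V, Z ⊆ ({w, v₁, v₂, v₃} : Finset V) → xh Z ≤ x Z)
    (hyh_le : ∀ Z : Finset V, Z ⊆ ({w, v₁, v₂, v₃} : Finset V) → yh Z ≤ y Z)
    (hxh_eq : ∀ Z : Finset V, Z ⊆ ({w, v₁, v₂, v₃} : Finset V) → w ∉ Z → xh Z = x Z)
    (hyh_eq : ∀ Z : Finset V, Z ⊆ ({w, v₁, v₂, v₃} : Finset V) → w ∉ Z → yh Z = y Z)
    (hρ1 : ∀ Z ∈ ({w, v₁, v₂, v₃} : Finset V).powerset, w ∉ Z → ρ Z = 1)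
    (hρle : ρ ({w, v₁, v₂, v₃} : Finset V) ≤ 1)
    (hρ₃0 : 0 ≤ ρ {w, v₃}) (hρ₁₂0 : 0 ≤ ρ {w, v₁, v₂})
    (hρ₃₂₃ : ρ {w, v₃} ≤ ρ {w, v₂, v₃}) (hρ₂₃P : ρ {w, v₂, v₃} ≤ ρ ({w, v₁, v₂, v₃} : Finset V))
    (hρ₁₂P : ρ {w, v₁, v₂} ≤ ρ ({w, v₁, v₂, v₃} : Finset V))
    (hPA : TracePA ({w, v₁, v₂, v₃} : Finset V) μ)
    (hCU₁ : TraceCUPA ({w, v₁, v₂, v₃} : Finset V) μ v₁)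
    (hCU₂ : TraceCUPA ({w, v₁, v₂, v₃} : Finset V) μ v₂)
    (hCU₃ : TraceCUPA ({w, v₁, v₂, v₃} : Finset V) μ v₃)
    (hCU₂₃ : ∀ f₁ f₂ : Finset V → R,
      (∀ Z Z' : Finset V, Z ⊆ Z' → Z' ⊆ ({w, v₁, v₂, v₃} : Finset V) → f₁ Z ≤ f₁ Z') →
      (∀ Z Z' : Finset V, Z ⊆ Z' → Z' ⊆ ({w, v₁, v₂, v₃} : Finset V) → f₂ Z ≤ f₂ Z') →
      (∀ Z : Finset V, Z ⊆ ({w, v₁, v₂, v₃} : Finset V) → 0 ≤ f₁ Z) →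
      (∀ Z : Finset V, Z ⊆ ({w, v₁, v₂, v₃} : Finset V) → 0 ≤ f₂ Z) →
      (∑ Z ∈ ({w, v₁, v₂, v₃} : Finset V).powerset.filter (fun Z => v₂ ∈ Z ∧ v₃ ∈ Z), f₁ Z * μ Z) *
          (∑ Z ∈ ({w, v₁, v₂, v₃} : Finset V).powerset.filter (fun Z => v₂ ∈ Z ∧ v₃ ∈ Z), f₂ Z * μ Z) ≤
        (∑ Z ∈ ({w, v₁, v₂, v₃} : Finset V).powerset.filter (fun Z => v₂ ∈ Z ∧ v₃ ∈ Z), f₁ Z * f₂ Z * μ Z) *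
          ∑ Z ∈ ({w, v₁, v₂, v₃} : Finset V).powerset.filter (fun Z => v₂ ∈ Z ∧ v₃ ∈ Z), μ Z) :
    0 ≤ ∑ Z ∈ ({w, v₁, v₂, v₃} : Finset V).powerset, μ Z * ρ Z *
      (xh Z * (∑ Z' ∈ ({w, v₁, v₂, v₃} : Finset V).powerset, μ Z') - ∑ Z' ∈ ({w, v₁, v₂, v₃} : Finset V).powerset, x Z' * μ Z') *
      (yh Z * (∑ Z' ∈ ({w, v₁, v₂, v₃} : Finset V).powerset, μ Z') - ∑ Z' ∈ ({w, v₁, v₂, v₃} : Finset V).powerset, y Z' * μ Z') := by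
  -- the coefficients: a three-way case split replacing `max` / `min`
  obtain ⟨a, ha⟩ : ∃ r : R, r = ρ {w, v₁, v₂} := ⟨_, rfl⟩
  obtain ⟨b, hb⟩ : ∃ r : R, r = ρ {w, v₃} := ⟨_, rfl⟩
  obtain ⟨c, hc⟩ : ∃ r : R, r = ρ {w, v₂, v₃} := ⟨_, rfl⟩
  obtain ⟨d, hd⟩ : ∃ r : R, r = ρ ({w, v₁, v₂, v₃} : Finset V) := ⟨_, rfl⟩
  rw [← ha] at hρ₁₂0 hρ₁₂P
  rw [← hb] at hρ₃0 hρ₃₂₃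
  rw [← hc] at hρ₃₂₃ hρ₂₃P
  rw [← hd] at hρle hρ₂₃P hρ₁₂P
  have hb_le_d : b ≤ d := hρ₃₂₃.trans hρ₂₃P
  rcases le_total (a + b) d with h₁ | h₁
  · rcases le_total a (c - b) with h₂ | h₂
    · -- CASE I: `c₅ = 0`, `c₃ = a`, the hard family carries `c − b − a`
      exact pathStar_functional_nonneg_of_coeffs hwv₁ hwv₂ hwv₃ hv₁₂ hv₁₃ hv₂₃ μ x y xh yh ρ
        (1 - d) (d - c) 0 a b 0 (c - b - a) hμ hμ0a hμ0b hx1 hy1 hxh1 hyh1 hxanti hyanti hxhanti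
        hyhanti hxh_le hyh_le hxh_eq hyh_eq hρ1 (by linarith) (by linarith) le_rfl hρ₁₂0 hρ₃0
        le_rfl (by linarith) (by rw [← ha]; ring) (by rw [← hb]; ring) (by rw [← hc]; ring)
        (by rw [← hd]; ring) (by ring) hPA hCU₁ hCU₂ hCU₃ hCU₂₃
    · -- CASE II: `c₅ = 0`, `c₃ = c − b`, `c₆ = 0`
      exact pathStar_functional_nonneg_of_coeffs hwv₁ hwv₂ hwv₃ hv₁₂ hv₁₃ hv₂₃ μ x y xh yh ρ
        (1 - d) (d - a - b) (a - c + b) (c - b) b 0 0 hμ hμ0a hμ0b hx1 hy1 hxh1 hyh1 hxanti hyanti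
        hxhanti hyhanti hxh_le hyh_le hxh_eq hyh_eq hρ1 (by linarith) (by linarith) (by linarith)
        (by linarith) hρ₃0 le_rfl le_rfl (by rw [← ha]; ring) (by rw [← hb]; ring)
        (by rw [← hc]; ring) (by rw [← hd]; ring) (by ring) hPA hCU₁ hCU₂ hCU₃ hCU₂₃
  · -- CASE III: `c₅ = a + b − d > 0`, `c₁ = c₆ = 0`
    exact pathStar_functional_nonneg_of_coeffs hwv₁ hwv₂ hwv₃ hv₁₂ hv₁₃ hv₂₃ μ x y xh yh ρ
      (1 - d) 0 (d - c) (c - b) (d - a) (a + b - d) 0 hμ hμ0a hμ0b hx1 hy1 hxh1 hyh1 hxanti hyanti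
      hxhanti hyhanti hxh_le hyh_le hxh_eq hyh_eq hρ1 (by linarith) le_rfl (by linarith)
      (by linarith) (by linarith) (by linarith) le_rfl (by rw [← ha]; ring) (by rw [← hb]; ring)
      (by rw [← hc]; ring) (by rw [← hd]; ring) (by ring) hPA hCU₁ hCU₂ hCU₃ hCU₂₃

end PathStarAll

end Summit.Ventures.PercRepro2.Coin
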